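import Literature.NumberTheory.LFunctions.ZetaScrew
import Literature.NumberTheory.LFunctions.RiemannXi
import Literature.NumberTheory.LFunctions.GeneralizedRH
import Summits.RiemannHypothesis.RiemannHypothesis.Theorems.IntegerScrewDiscreteLandau
import Summits.RiemannHypothesis.RiemannHypothesis.Theses.SparseScrewLandau

/-!
# Lead prover's skeleton (from the BC3 birth skeleton; stub statements inlined) — crux `SparseScrewLandau.QuarticSampleLandau` = stmt-RiemannHypothesis-23405 (rh-idea-6 g2, LINE 5; route-RiemannHypothesis-SparseScrewLandau rev 0, commit 5b9c52f3a469)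

Registered form: concludes the ROUTE decl by name (imports the gate-written Theses module).

`QuarticSampleLandau : (∃ K, ∀ n ≥ 1, -K ≤ Ψ(4 log n)) → RiemannHypothesis` (Ψ = `zetaScrew`).

Line «quartic-chord»: two registered stubs + a kernel-checked composition.

* `stub_primeSumConvexCombo` — the prime sum `φ = zetaScrewPrimeSum` is CONVEX on `[0, ∞)`
  (a positive combination, weights `Λ(n) n^{-1/2} ≥ 0`, of the hinge functions `t ↦ (t - log n)₊`),
  stated as the two-point convexity inequality. PRIME-SIDE INPUT: `Λ ≥ 0`, nothing else.
* `stub_smoothPartQuarticDefect` — the smooth part `G = Ψ + φ` (archimedean `4(e^{t/2}+e^{-t/2}-2)`,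
  linear term, Hurwitz–Lerch term) loses at most a constant `D` against its chord on every quartic cell
  `[4 log n, 4 log (n+1)]`: the archimedean part is `C²` with `G'' ≤ e^{t/2} + e^{-t/2}`, and
  `(cell length)² · sup e^{t/2} / 8 ≤ (4/n)² (n+1)² / 8 ≤ 8`; the Hurwitz–Lerch part is monotone and
  bounded (total variation `≤ ζ(2,1/4)/4`), the linear part is affine. Also locates the cell of `t`.
* composition `QuarticSampleLandau_of`: `Ψ(t) = G(t) - φ(t) ≥ chord_Ψ(t) - D ≥ -K - D` on `[0,∞)`,
  then the tree's RH-free `IntegerScrewDiscreteLandau.robustLandau` (Landau–Widder on the Laplace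
  transform with slack `K + D`) excludes zeros of `ξ(1/2 + w)` in `Re w > 0`, i.e. RH
  (`riemannXi_eq_zero_iff_holds`, `quasiRiemannHypothesis_one_half_iff_holds`).
-/

noncomputable section
set_option linter.dupNamespace false

namespace Summit.RiemannHypothesis.RiemannHypothesis.Cruxes.QuarticSampleLandau.Lead

open Literature.NumberTheory.LFunctions
open Summit.RiemannHypothesis.RiemannHypothesis.Theorems.IntegerScrewDiscreteLandau (robustLandau)

/-- Stub 1 (PRIME SIDE): two-point convexity of the prime sum `φ = zetaScrewPrimeSum` on `[0, ∞)`
(from `Λ ≥ 0`). -/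
theorem stub_primeSumConvexCombo :
    ∀ u v s : ℝ, 0 ≤ u → u ≤ v → 0 ≤ s → s ≤ 1 →
      zetaScrewPrimeSum (s * u + (1 - s) * v) ≤
        s * zetaScrewPrimeSum u + (1 - s) * zetaScrewPrimeSum v := by
  sorry

/-- Stub 2 (SMOOTH PART): on the quartic cell `[4 log n, 4 log (n+1)]` containing `t ≥ 0`, the smooth
part `G = Ψ + φ` lies above its chord minus a uniform constant `D`. -/
theorem stub_smoothPartQuarticDefect :
    ∃ D : ℝ, ∀ t : ℝ, 0 ≤ t → ∃ n : ℕ, 1 ≤ n ∧ ∃ s : ℝ, 0 ≤ s ∧ s ≤ 1 ∧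
      t = s * (4 * Real.log n) + (1 - s) * (4 * Real.log ((n : ℝ) + 1)) ∧
      s * (zetaScrew (4 * Real.log n) + zetaScrewPrimeSum (4 * Real.log n)) +
          (1 - s) * (zetaScrew (4 * Real.log ((n : ℝ) + 1)) +
            zetaScrewPrimeSum (4 * Real.log ((n : ℝ) + 1)))
          - D ≤ zetaScrew t + zetaScrewPrimeSum t := by
  sorry

/-- COMPOSITION (kernel-checked, no sorry of its own): the two stubs give a global floor
`Ψ ≥ -(K + D)` on `[0, ∞)`, and robust Landau detection turns the floor into RH. -/
theorem QuarticSampleLandau_of :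
    Summit.RiemannHypothesis.RiemannHypothesis.Theses.SparseScrewLandau.QuarticSampleLandau := by
  have h1 := stub_primeSumConvexCombo
  rintro ⟨K, hK⟩
  obtain ⟨D, hD⟩ := stub_smoothPartQuarticDefect
  have hbdd : ∀ t : ℝ, 0 ≤ t → -(K + D) ≤ zetaScrew t := by
    intro t ht
    obtain ⟨n, hn, s, hs0, hs1, hts, hG⟩ := hD t ht
    have hn0 : (0 : ℝ) < n := by exact_mod_cast (by omega : 0 < n)
    have hn1 : (1 : ℝ) ≤ n := by exact_mod_cast hn
    have hu : 0 ≤ 4 * Real.log n := by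
      have := Real.log_nonneg hn1
      linarith
    have huv : 4 * Real.log n ≤ 4 * Real.log ((n : ℝ) + 1) := by
      have := Real.log_le_log hn0 (by linarith : (n : ℝ) ≤ (n : ℝ) + 1)
      linarith
    have hφ := h1 (4 * Real.log n) (4 * Real.log ((n : ℝ) + 1)) s hu huv hs0 hs1
    rw [← hts] at hφ
    have hKn : -K ≤ zetaScrew (4 * Real.log n) := hK n hn
    have hKn1 : -K ≤ zetaScrew (4 * Real.log ((n : ℝ) + 1)) := by
      have h := hK (n + 1) (by omega)
      have hc : ((n + 1 : ℕ) : ℝ) = (n : ℝ) + 1 := by push_cast; ring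
      rw [hc] at h
      exact h
    have hA : s * (-K) ≤ s * zetaScrew (4 * Real.log n) := mul_le_mul_of_nonneg_left hKn hs0
    have hB : (1 - s) * (-K) ≤ (1 - s) * zetaScrew (4 * Real.log ((n : ℝ) + 1)) :=
      mul_le_mul_of_nonneg_left hKn1 (by linarith)
    nlinarith [hA, hB, hφ, hG]
  -- robust Landau detection: no zeros of `ξ(1/2 + ·)` in `Re > 0`, i.e. RH
  refine quasiRiemannHypothesis_one_half_iff_holds.1 fun s hs h1' h2' ↦ ?_
  have hξ : riemannXi s = 0 := (riemannXi_eq_zero_iff_holds s).2 ⟨hs, by linarith, h2'⟩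
  have hw : 0 < (s - 1 / 2).re := by simp; linarith
  refine robustLandau (K + D) hbdd (s - 1 / 2) hw ?_
  rw [show (1 / 2 : ℂ) + (s - 1 / 2) = s by ring]
  exact hξ

end Summit.RiemannHypothesis.RiemannHypothesis.Cruxes.QuarticSampleLandau.Lead

end
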